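import Summits.NavierStokesRegularity.NavierStokesRegularity.Theorems.TypeILiouvilleTypeIliouvilleNoTypeIIEternalProfile
import Literature.Analysis.FunctionSpaces.LittlewoodPaleyProofs
import HarnessLib

/-!
# REACH: a critical `L^q` rate (`3 < q < ∞`) already gives the sup-norm Type-I rate — by scaling alone
# (crux `TypeIliouvilleNoTypeII`, stmt-NavierStokesRegularity-0056; §B keep/kill calibration)

The hard core `NoTypeII` is the POINTWISE sup-rate `‖u(t)‖_∞ ≤ C/√(T − t)` (Albritton–Barker's
`(c_∞)`).  For `3 < q < ∞` the critical `L^q` rate `(c_q)`: `‖u(t)‖_{L^q} ≤ C/(T − t)^{(1 − 3/q)/2}`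
is the `L^q`-analogue (same scaling).  Albritton–Barker 2019 (arXiv:1811.00502, footnote p. 4) remark
that for mild solutions `(c_{q₁}) ⇒ (c_{q₂})` for `q₂ ≥ q₁`, in particular `(c_q) ⇒ (c_∞)`, by the
`L^q` local smoothing theory.  This file proves, for the class of the crux (maximal classical solutions
of unforced Navier–Stokes on `ℝ³ × [0,T)`, Leray–Hopf from a rapidly decaying datum),

  `isTypeIBlowup_of_lqRate : (c_q) near T ⇒ IsTypeIBlowup u T`     (`3 < q < ∞`),

WITHOUT any smoothing theory and WITHOUT a Liouville theorem, by SCALING + FATOU through the Type-II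
zoom: if the blow-up were not Type I, the Type-II package
(`EternalProfile.exists_eternalProfile_of_not_isTypeIBlowup`; twin of ns-typeII-p2's
`TypeIIZoom.exists_typeIIZoomPackage`) gives near-maximum centres `(t_k, x_k)`, levels `M_k` with the
Type-II signature `k√ν ≤ M_k√(T − t_k)`, zooms `w_k(s,y) = M_k⁻¹u(t_k + sν/M_k², x_k + yν/M_k)`
converging pointwise (along `φ`) to a bounded eternal `W` with `‖W(0,0)‖ ≥ 1/4`.  But at `s = 0`

  `‖w_k(0)‖_{L^q} = M_k⁻¹ (M_k/ν)^{3/q} ‖u(t_k)‖_{L^q} ≤ C ν^{−3/q} (M_k²(T − t_k))^{−(1−3/q)/2}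
                  ≤ C ν^{−3/q} (k²ν)^{−(1−3/q)/2} → 0`,

so Fatou (`eLpNorm_lim_le_liminf_eLpNorm`) gives `‖W(0)‖_{L^q} = 0`, `W(0,·) ≡ 0` by continuity —
contradiction.  (The exponent `(1 − 3/q)/2 > 0` is exactly where `q > 3` enters; at `q = 3` the zooms
keep their `L³` norm and one needs the Escauriaza–Seregin–Šverák Liouville theorem instead; at
`q = ∞` the statement is the identity.)

Use for the §B critics (K2e REACH): a candidate estimate whose conclusion is a critical `L^q` rate,
`3 < q < ∞`, REACHES the hard core's `C3` form BY NAME through `isTypeIBlowup_of_lqRate` /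
`typeIliouvilleNoTypeII_of_lqRate`; the converse `(c_∞) ⇒ (c_q)` is not claimed (finite energy and
the sup-rate interpolate only to the rate exponent `(1 − 2/q)/2 > (1 − 3/q)/2`), so such a clause is
a priori STRONGER than the crux.  Nothing here bears on regularity or blow-up. [folklore]

References: Albritton–Barker 2019, §1 (notions `(c_p)`, footnote p. 4); Koch–Nadirashvili–Seregin–
Šverák 2009, §6 (the zoom); Leray 1934 §20 (similarity).
-/

noncomputable section

-- the summit and its single problem share the name `NavierStokesRegularity` (D-0017 nested layout)
set_option linter.dupNamespace false

open Set Function Filter Topology MeasureTheory Metric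
open scoped NNReal ENNReal

namespace Summit.NavierStokesRegularity.NavierStokesRegularity.Theorems.TypeIliouvilleNoTypeII.LpRateReach

open Literature.Analysis Literature.Analysis.FluidPDE
open Summit.NavierStokesRegularity.NavierStokesRegularity.Theorems.TypeIliouvilleNoTypeII.EternalProfile

/-! ## The `L^q` norm of the zoom slice at the centre time -/

/-- The slice `s = 0` of the window zoom is the rescaled, translated, dilated centre slice
`y ↦ M⁻¹ u(t₀, x₀ + (ν/M) y)`. [folklore] -/
theorem windowZoom_slice_zero {ν M t₀ : ℝ}
    {u : ℝ → EuclideanSpace ℝ (Fin 3) → EuclideanSpace ℝ (Fin 3)} {x₀ : EuclideanSpace ℝ (Fin 3)} :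
    (M⁻¹ • stPull (ν / M ^ 2) (ν / M) t₀ x₀ u) 0 =
      M⁻¹ • fun y => u t₀ (x₀ + (ν / M) • y) := by
  funext y
  show M⁻¹ • stPull (ν / M ^ 2) (ν / M) t₀ x₀ u 0 y = M⁻¹ • u t₀ (x₀ + (ν / M) • y)
  rw [stPull_apply, mul_zero, add_zero]

/-- Change of variables in `L^q(ℝ³)` under translation and dilation:
`‖f(x₀ + γ ·)‖_{L^q} = (γ³)^{-1/q} ‖f‖_{L^q}` for `γ > 0` (the tree's `eLpNorm_comp_smul` plus
translation invariance of Lebesgue measure). [folklore] -/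
theorem eLpNorm_comp_add_smul (q : ℝ≥0∞)
    {f : EuclideanSpace ℝ (Fin 3) → EuclideanSpace ℝ (Fin 3)} (hf : AEStronglyMeasurable f volume)
    (x₀ : EuclideanSpace ℝ (Fin 3)) {γ : ℝ} (hγ : 0 < γ) :
    eLpNorm (fun y => f (x₀ + γ • y)) q volume =
      ENNReal.ofReal ((γ ^ 3)⁻¹) ^ (1 / q).toReal * eLpNorm f q volume := by
  have h1 : (fun y => f (x₀ + γ • y)) = fun y => (fun z => f (x₀ + z)) (γ • y) := rfl
  rw [h1, Literature.Analysis.FunctionSpaces.eLpNorm_comp_smul q (fun z => f (x₀ + z)) hγ.ne',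
    finrank_euclideanSpace_fin, abs_of_pos (by positivity)]
  congr 1
  have h2 : (fun z => f (x₀ + z)) = f ∘ (fun z => x₀ + z) := rfl
  rw [h2, eLpNorm_comp_measurePreserving hf (measurePreserving_add_left volume x₀)]

/-- **The `L^q` norm of the centre slice of a window zoom**, as a real bound: if
`‖u(t₀)‖_{L^q} ≤ A` (extended norm `≤ ofReal A`), `M, ν > 0`, `0 < q < ∞`, then
`‖w(0)‖_{L^q} ≤ M⁻¹ (M/ν)^{3/q} A` for `w = M⁻¹ • stPull (ν/M²) (ν/M) t₀ x₀ u`. [cite: Leray1934, §20] -/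
theorem eLpNorm_windowZoom_zero_le {ν M t₀ A q : ℝ} (hν : 0 < ν) (hM : 0 < M) (hq : 0 < q)
    {u : ℝ → EuclideanSpace ℝ (Fin 3) → EuclideanSpace ℝ (Fin 3)}
    {x₀ : EuclideanSpace ℝ (Fin 3)} (hu : AEStronglyMeasurable (u t₀) volume)
    (hbd : eLpNorm (u t₀) (ENNReal.ofReal q) volume ≤ ENNReal.ofReal A) :
    eLpNorm ((M⁻¹ • stPull (ν / M ^ 2) (ν / M) t₀ x₀ u) 0) (ENNReal.ofReal q) volume ≤
      ENNReal.ofReal (M⁻¹ * (M / ν) ^ (3 / q) * A) := by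
  have hγ : 0 < ν / M := div_pos hν hM
  rw [windowZoom_slice_zero, eLpNorm_const_smul, eLpNorm_comp_add_smul _ hu x₀ hγ]
  -- the scalar factors
  have hq0 : (ENNReal.ofReal q) ≠ 0 := (ENNReal.ofReal_pos.2 hq).ne'
  have hexp : (1 / ENNReal.ofReal q).toReal = 1 / q := by
    rw [ENNReal.toReal_div, ENNReal.toReal_one, ENNReal.toReal_ofReal hq.le]
  have hfac : ENNReal.ofReal (((ν / M) ^ 3)⁻¹) ^ (1 / ENNReal.ofReal q).toReal =
      ENNReal.ofReal ((M / ν) ^ (3 / q)) := by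
    rw [hexp, ENNReal.ofReal_rpow_of_nonneg (by positivity) (by positivity)]
    congr 1
    have hMν : 0 < M / ν := div_pos hM hν
    rw [show ((ν / M) ^ 3)⁻¹ = (M / ν) ^ (3 : ℝ) by
      rw [show (3 : ℝ) = ((3 : ℕ) : ℝ) by norm_num, Real.rpow_natCast, ← inv_pow, inv_div]]
    rw [← Real.rpow_mul hMν.le]
    congr 1
    ring
  have hMinv : ‖(M⁻¹ : ℝ)‖ₑ = ENNReal.ofReal M⁻¹ := Real.enorm_eq_ofReal (inv_nonneg.2 hM.le)
  rw [hfac, hMinv]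
  calc ENNReal.ofReal M⁻¹ * (ENNReal.ofReal ((M / ν) ^ (3 / q)) * eLpNorm (u t₀) (ENNReal.ofReal q) volume)
      ≤ ENNReal.ofReal M⁻¹ * (ENNReal.ofReal ((M / ν) ^ (3 / q)) * ENNReal.ofReal A) := by
        gcongr
    _ = ENNReal.ofReal (M⁻¹ * (M / ν) ^ (3 / q) * A) := by
        rw [← ENNReal.ofReal_mul (by positivity), ← ENNReal.ofReal_mul (inv_nonneg.2 hM.le),
          mul_assoc]

/-! ## The scaling bookkeeping at a Type-II centre -/

/-- At a centre with the Type-II signature `k√ν ≤ M√(T − t)` (`k ≥ 1`), the zoomed `L^q` bound is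
small: `M⁻¹ (M/ν)^{3/q} · C/(T − t)^{a} ≤ C ν^{-3/q} (k²ν)^{-a}` with `a = (1 − 3/q)/2 > 0`
(indeed `M⁻¹(M/ν)^{3/q}(T−t)^{-a} = ν^{-3/q} (M²(T − t))^{-a}`). [folklore] -/
theorem zoomFactor_le {ν M T t C q : ℝ} {k : ℕ} (hν : 0 < ν) (hM : 0 < M) (htT : t < T)
    (hq : 3 < q) (hC : 0 ≤ C) (hk : 1 ≤ k)
    (hsig : (k : ℝ) * Real.sqrt ν ≤ M * Real.sqrt (T - t)) :
    M⁻¹ * (M / ν) ^ (3 / q) * (C / (T - t) ^ ((1 - 3 / q) / 2)) ≤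
      C * ν ^ (-(3 / q)) * (((k : ℝ) ^ 2 * ν) ^ (-((1 - 3 / q) / 2))) := by
  have hTt : 0 < T - t := sub_pos.2 htT
  have hq0 : 0 < q := by linarith
  have ha : 0 < (1 - 3 / q) / 2 := by
    have : 3 / q < 1 := by rw [div_lt_one hq0]; exact hq
    linarith
  set a : ℝ := (1 - 3 / q) / 2 with ha_def
  -- rewrite the left side as `C ν^{-3/q} (M²(T−t))^{-a}`
  have hlhs : M⁻¹ * (M / ν) ^ (3 / q) * (C / (T - t) ^ a) =
      C * ν ^ (-(3 / q)) * ((M ^ 2 * (T - t)) ^ (-a)) := by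
    have hM2 : M ^ 2 * (T - t) = M ^ (2 : ℝ) * (T - t) := by norm_cast
    rw [hM2, Real.mul_rpow (by positivity) hTt.le, ← Real.rpow_mul hM.le, Real.div_rpow hM.le hν.le,
      Real.rpow_neg hν.le, Real.rpow_neg hTt.le]
    have hMa : M⁻¹ * M ^ (3 / q) = M ^ (2 * -a) := by
      rw [show 2 * -a = -1 + 3 / q by rw [ha_def]; ring, Real.rpow_add hM, Real.rpow_neg_one]
    calc M⁻¹ * (M ^ (3 / q) / ν ^ (3 / q)) * (C / (T - t) ^ a)
        = (M⁻¹ * M ^ (3 / q)) * (ν ^ (3 / q))⁻¹ * (C * ((T - t) ^ a)⁻¹) := by ring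
      _ = M ^ (2 * -a) * (ν ^ (3 / q))⁻¹ * (C * ((T - t) ^ a)⁻¹) := by rw [hMa]
      _ = C * (ν ^ (3 / q))⁻¹ * (M ^ (2 * -a) * ((T - t) ^ a)⁻¹) := by ring
  rw [hlhs]
  -- monotonicity: `k²ν ≤ M²(T − t)` and `-a < 0`
  have hkν : (k : ℝ) ^ 2 * ν ≤ M ^ 2 * (T - t) := by
    have h1 : 0 ≤ (k : ℝ) * Real.sqrt ν := by positivity
    have h2 := mul_self_le_mul_self h1 hsig
    have e1 : (k : ℝ) * Real.sqrt ν * ((k : ℝ) * Real.sqrt ν) = (k : ℝ) ^ 2 * ν := by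
      rw [show (k : ℝ) * Real.sqrt ν * ((k : ℝ) * Real.sqrt ν) =
        (k : ℝ) ^ 2 * (Real.sqrt ν * Real.sqrt ν) by ring, Real.mul_self_sqrt hν.le]
    have e2 : M * Real.sqrt (T - t) * (M * Real.sqrt (T - t)) = M ^ 2 * (T - t) := by
      rw [show M * Real.sqrt (T - t) * (M * Real.sqrt (T - t)) =
        M ^ 2 * (Real.sqrt (T - t) * Real.sqrt (T - t)) by ring, Real.mul_self_sqrt hTt.le]
    rwa [e1, e2] at h2
  have hkpos : 0 < (k : ℝ) ^ 2 * ν := by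
    have : (1 : ℝ) ≤ k := by exact_mod_cast hk
    positivity
  have hmono : (M ^ 2 * (T - t)) ^ (-a) ≤ ((k : ℝ) ^ 2 * ν) ^ (-a) :=
    Real.rpow_le_rpow_of_nonpos hkpos hkν (by linarith)
  have hCν : 0 ≤ C * ν ^ (-(3 / q)) := mul_nonneg hC (Real.rpow_nonneg hν.le _)
  exact mul_le_mul_of_nonneg_left hmono hCν

/-- The small factor tends to zero: `C ν^{-3/q} (k²ν)^{-a} → 0` as `k → ∞` (`a > 0`, `ν > 0`). [folklore] -/
theorem tendsto_zoomBound_zero {ν C q : ℝ} (hν : 0 < ν) (hq : 3 < q) :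
    Tendsto (fun k : ℕ => C * ν ^ (-(3 / q)) * (((k : ℝ) ^ 2 * ν) ^ (-((1 - 3 / q) / 2))))
      atTop (𝓝 0) := by
  have hq0 : 0 < q := by linarith
  have ha : 0 < (1 - 3 / q) / 2 := by
    have : 3 / q < 1 := by rw [div_lt_one hq0]; exact hq
    linarith
  -- `k ↦ k² ν → ∞`, then `x ↦ x^{-a} → 0`
  have h1 : Tendsto (fun k : ℕ => (k : ℝ) ^ 2 * ν) atTop atTop := by
    refine Tendsto.atTop_mul_const hν ?_
    exact (tendsto_pow_atTop two_ne_zero).comp tendsto_natCast_atTop_atTop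
  have h2 : Tendsto (fun k : ℕ => ((k : ℝ) ^ 2 * ν) ^ (-((1 - 3 / q) / 2))) atTop (𝓝 0) :=
    (tendsto_rpow_neg_atTop ha).comp h1
  have h3 := h2.const_mul (C * ν ^ (-(3 / q)))
  rw [mul_zero] at h3
  exact h3

/-! ## The reach theorem -/

/-- **A critical `L^q` rate, `3 < q < ∞`, forces the sup-norm Type-I rate** (Albritton–Barker's
`(c_q) ⇒ (c_∞)` for the class of the hard core `NoTypeII`, proved by scaling + Fatou through the
Type-II zoom; see the module docstring).  Hypotheses: the frame of the crux, `3 < q`, and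
`‖u(t)‖_{L^q} ≤ C/(T − t)^{(1−3/q)/2}` (as an extended-norm bound) for `t ∈ (t₁, T)`.  Conclusion:
`IsTypeIBlowup u T`. [cite: AlbrittonBarker2019, §1 footnote p. 4 (arXiv:1811.00502)] -/
theorem isTypeIBlowup_of_lqRate (ν T : ℝ) (hν : 0 < ν) (hT : 0 < T)
    (u : ℝ → EuclideanSpace ℝ (Fin 3) → EuclideanSpace ℝ (Fin 3))
    (p : ℝ → EuclideanSpace ℝ (Fin 3) → ℝ) (hmax : IsMaximalSmoothSolution ν 0 u p T)
    (hLH : IsLerayHopfOn T ν 0 (u 0) u) (hdec : HasRapidSpatialDecay (u 0))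
    {q : ℝ} (hq : 3 < q) {C t₁ : ℝ} (hC : 0 ≤ C) (ht₁ : t₁ < T)
    (hrate : ∀ t ∈ Ioo t₁ T,
      eLpNorm (u t) (ENNReal.ofReal q) volume ≤ ENNReal.ofReal (C / (T - t) ^ ((1 - 3 / q) / 2))) :
    IsTypeIBlowup u T := by
  have _ht₁ := ht₁
  by_contra hII
  obtain ⟨tc, xc, M, φ, W, hφ, hM, htI, hlate, hsig, -, -, -, hWs, -, -, -, h0, hval, -⟩ :=
    exists_eternalProfile_of_not_isTypeIBlowup ν T hν hT u p hmax hLH hdec hII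
  have hq0 : 0 < q := by linarith
  have hqe0 : ENNReal.ofReal q ≠ 0 := (ENNReal.ofReal_pos.2 hq0).ne'
  -- the zooms and their centre slices
  set w : ℕ → ℝ → EuclideanSpace ℝ (Fin 3) → EuclideanSpace ℝ (Fin 3) :=
    fun k => (M k)⁻¹ • stPull (ν / M k ^ 2) (ν / M k) (tc k) (xc k) u with hw
  have hcontu : ∀ k, Continuous (u (tc k)) := fun k =>
    (hmax.1.contDiff_velocity (htI k)).continuous
  have hmeas0 : ∀ k, AEStronglyMeasurable (w k 0) volume := by
    intro k
    have hc : Continuous (w k 0) := by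
      have e : w k 0 = (M k)⁻¹ • fun y => u (tc k) (xc k + (ν / M k) • y) := windowZoom_slice_zero
      rw [e]
      have h1 : Continuous fun y : EuclideanSpace ℝ (Fin 3) => xc k + (ν / M k) • y :=
        continuous_const.add ((continuous_const (y := ν / M k)).smul continuous_id)
      exact ((hcontu k).comp h1).const_smul (M k)⁻¹
    exact hc.aestronglyMeasurable
  -- the bound at the centres: eventually `tc k > t₁` (the centres tend to `T`)
  set b : ℕ → ℝ := fun k => C * ν ^ (-(3 / q)) * (((k : ℝ) ^ 2 * ν) ^ (-((1 - 3 / q) / 2))) with hb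
  have hlateT : ∀ᶠ k : ℕ in atTop, t₁ < tc k ∧ 1 ≤ k := by
    have hTt₁ : 0 < T - t₁ := sub_pos.2 ht₁
    obtain ⟨N, hN⟩ := exists_nat_gt (1 / (T - t₁))
    refine (eventually_ge_atTop (max N 1)).mono fun k hk => ⟨?_, le_of_max_le_right hk⟩
    have hkN : (N : ℝ) ≤ k := by exact_mod_cast le_of_max_le_left hk
    have hk1 : (0 : ℝ) < (k : ℝ) + 1 := by positivity
    have h1 : 1 / ((k : ℝ) + 1) < T - t₁ := by
      rw [div_lt_iff₀ hk1]
      have h2 : 1 < (T - t₁) * N := by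
        have := (div_lt_iff₀ hTt₁).1 hN
        linarith
      nlinarith
    linarith [hlate k]
  have hbound : ∀ᶠ k : ℕ in atTop, eLpNorm (w k 0) (ENNReal.ofReal q) volume ≤ ENNReal.ofReal (b k) := by
    filter_upwards [hlateT] with k hk
    have h1 := eLpNorm_windowZoom_zero_le (t₀ := tc k) (x₀ := xc k) hν (hM k) hq0
      (hcontu k).aestronglyMeasurable (hrate (tc k) ⟨hk.1, (htI k).2⟩)
    refine h1.trans (ENNReal.ofReal_le_ofReal ?_)
    exact zoomFactor_le hν (hM k) (htI k).2 hq hC hk.2 (hsig k)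
  -- Fatou along the subsequence `φ`
  have hF : eLpNorm (W 0) (ENNReal.ofReal q) volume ≤
      atTop.liminf fun j => eLpNorm (w (φ j) 0) (ENNReal.ofReal q) volume :=
    MeasureTheory.Lp.eLpNorm_lim_le_liminf_eLpNorm (fun j => hmeas0 (φ j)) (W 0)
      (Eventually.of_forall fun y => hval 0 y)
  have hφb : Tendsto (fun j => ENNReal.ofReal (b (φ j))) atTop (𝓝 0) := by
    have h1 : Tendsto (fun j => b (φ j)) atTop (𝓝 0) :=
      (tendsto_zoomBound_zero (C := C) hν hq).comp hφ.tendsto_atTop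
    have h2 := ENNReal.tendsto_ofReal h1
    rwa [ENNReal.ofReal_zero] at h2
  have hev : ∀ᶠ j in atTop,
      eLpNorm (w (φ j) 0) (ENNReal.ofReal q) volume ≤ ENNReal.ofReal (b (φ j)) :=
    hφ.tendsto_atTop.eventually hbound
  have hlim0 : atTop.liminf (fun j => eLpNorm (w (φ j) 0) (ENNReal.ofReal q) volume) = 0 := by
    refine le_antisymm ?_ bot_le
    calc atTop.liminf (fun j => eLpNorm (w (φ j) 0) (ENNReal.ofReal q) volume)
        ≤ atTop.liminf (fun j => ENNReal.ofReal (b (φ j))) := liminf_le_liminf hev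
      _ = 0 := hφb.liminf_eq
  have hW0 : eLpNorm (W 0) (ENNReal.ofReal q) volume = 0 :=
    le_antisymm (hF.trans (le_of_eq hlim0)) bot_le
  -- `W(0, ·) = 0` a.e., hence everywhere by continuity
  have hWc : Continuous (W 0) :=
    hWs.continuous.comp (Continuous.prodMk_right (0 : ℝ))
  have hae : W 0 =ᵐ[volume] (fun _ => 0) :=
    (eLpNorm_eq_zero_iff hWc.aestronglyMeasurable hqe0).1 hW0
  have hW00 : W 0 = fun _ => 0 := Measure.eq_of_ae_eq hae hWc continuous_const
  have : W 0 0 = 0 := by rw [hW00]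
  rw [this, norm_zero] at h0
  linarith

/-- **`NoTypeII` from an a-priori critical `L^q` rate estimate** (`3 < q < ∞`; concluded BY NAME for
the hard core `Theses.TypeILiouville.TypeIliouvilleNoTypeII`): if every maximal classical solution of
unforced Navier–Stokes on `ℝ³ × [0,T)`, Leray–Hopf from a rapidly decaying datum, obeys
`‖u(t)‖_{L^q} ≤ C/(T − t)^{(1−3/q)/2}` near `T` for some `q ∈ (3, ∞)` and `C`, then every such blow-up
is Type I.  This is the REACH step (clause ⇒ `C3`) for every §B candidate typed as a critical `L^q`
rate. [cite: AlbrittonBarker2019, §1 footnote p. 4 (arXiv:1811.00502)] -/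
theorem typeIliouvilleNoTypeII_of_lqRate
    (hLq : ∀ (ν T : ℝ), 0 < ν → 0 < T →
      ∀ (u : ℝ → EuclideanSpace ℝ (Fin 3) → EuclideanSpace ℝ (Fin 3))
        (p : ℝ → EuclideanSpace ℝ (Fin 3) → ℝ),
      IsMaximalSmoothSolution ν 0 u p T → IsLerayHopfOn T ν 0 (u 0) u →
      HasRapidSpatialDecay (u 0) →
      ∃ q C t₁ : ℝ, 3 < q ∧ 0 ≤ C ∧ t₁ < T ∧ ∀ t ∈ Ioo t₁ T,
        eLpNorm (u t) (ENNReal.ofReal q) volume ≤ ENNReal.ofReal (C / (T - t) ^ ((1 - 3 / q) / 2))) :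
    Summit.NavierStokesRegularity.NavierStokesRegularity.Theses.TypeILiouville.TypeIliouvilleNoTypeII := by
  intro ν T hν hT u p hmax hLH hdec
  obtain ⟨q, C, t₁, hq, hC, ht₁, hrate⟩ := hLq ν T hν hT u p hmax hLH hdec
  exact isTypeIBlowup_of_lqRate ν T hν hT u p hmax hLH hdec hq hC ht₁ hrate

end Summit.NavierStokesRegularity.NavierStokesRegularity.Theorems.TypeIliouvilleNoTypeII.LpRateReach

end
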